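import Summits.QuantumFields.YangMills.Theorems.LuscherReductionTraceDoorOST
import Summits.QuantumFields.YangMills.Theorems.LuscherReductionRunningReductionOneSiteTailClosed
import HarnessLib

/-!
# One-site trace limit, UNCONDITIONAL: the registered stub S-OSTL `stub_oneSiteTraceLimit` of line «twolattice» on crux
# `TwistedTraceScaling` (stmt-QuantumFields-20203), BY NAME from tree theorems

Route `LuscherReduction` (owner ym-beyond-p1), child crux `TwistedTraceScaling` (stmt-QuantumFields-20203), registered birth line
«twolattice» (`pub/ym-beyond/p1-g20-files/Lines-twolattice.lean`, sha16 a5c3dbcbf75f28d1), stub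

  `TwoLattice.stub_oneSiteTraceLimit : Stmt.stub_oneSiteTraceLimit`,
  `Stmt.stub_oneSiteTraceLimit := ∀ s > 0, ∀ ε > 0, ∃ B0, ∀ B ≥ B0, ∀ T, |T·λ_b(B) − s| ≤ λ_b(B) → |levelRatio 1 B T − hTraceRatio s| ≤ ε`

(VERBATIM the KTR r8 text `TT.OneSiteTraceLimit` over the tree objects of `Theorems/LuscherReductionTraceDoorDefs.lean`): the
dyadic LEVEL ratio `m(2T)/m(T)²`, `m(T) = Σ_k (μ_k/μ_0)^T`, of the ONE-SITE three-matrix `SU(2)` model (`L = 1`) tends to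
Lüscher's `r_𝔥(s) = Σ_k e^{−2sΔ_k}/(Σ_k e^{−sΔ_k})²` when `T·λ_b → s`.

This file discharges it with NO hypothesis left: the glue `TraceDoor.oneSiteTraceLimit_of_oneSiteTail : OneSiteTail → ⟨text⟩`
(ym-infvol-p1 g4, `…TraceDoorOST.lean`, skeleton PART 8 «OST» re-homed; inputs ONE = `oneSiteLevels_proof` and
`LGS.levelGapSummable_all`) applied to the CLOSED child `OneSiteTail` (stmt-QuantumFields-20204, `OST.oneSiteTail_proof`,
ym-luscher-20007-p1 g4, `…OneSiteTailClosed.lean`).  In the skeleton: `stub_oneSiteTraceLimit := TraceDoor.oneSiteTraceLimit`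
(the statement below is the body of `Stmt.stub_oneSiteTraceLimit` character for character under the skeleton's `open`s).

HONEST FRAMING: a one-line composition of two tree theorems; the content is ONE (crux 20007) + the B-uniform tail (item 20204) +
the elementary real analysis of PART 8.  One-site (`L = 1`) lattice quantum mechanics only; femto rung R2b1; nothing of the RG
statement (TOWER), of the fixed-lattice law (BASE), of infinite volume, of a gap, or of Clay.
-/

set_option autoImplicit false

noncomputable section

namespace Summit.QuantumFields.YangMills.Theorems.FemtoTransferGap.TraceDoor

open Summit.QuantumFields.YangMills.Theorems.FemtoTransferGap

/-- ★ **One-site trace limit (S-OSTL of line «twolattice», unconditional).**  For every femto-time `s > 0` and `ε > 0` there is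
`B0` such that for every one-site coupling `B ≥ B0` and every number of transfer steps `T` with `|T·λ_b(B) − s| ≤ λ_b(B)`
(`λ_b = bareLambda B = (2/B)^{1/3}`), the dyadic level ratio of the one-site model is within `ε` of Lüscher's `r_𝔥(s)`:
`|levelRatio 1 B T − hTraceRatio s| ≤ ε`.  Proof: `oneSiteTraceLimit_of_oneSiteTail OST.oneSiteTail_proof`.
[cite: Luscher1983, §3] [cite: Simon1983, Thm 1.1] -/
theorem oneSiteTraceLimit :
    ∀ s : ℝ, 0 < s → ∀ ε : ℝ, 0 < ε → ∃ B0 : ℝ, ∀ B : ℝ, B0 ≤ B → ∀ T : ℕ,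
      |(T : ℝ) * bareLambda B - s| ≤ bareLambda B → |levelRatio 1 B T - hTraceRatio s| ≤ ε :=
  oneSiteTraceLimit_of_oneSiteTail OST.oneSiteTail_proof

end Summit.QuantumFields.YangMills.Theorems.FemtoTransferGap.TraceDoor

end
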